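import Mathlib
import Summits.Ventures.PercRepro2.Defs
import Summits.Ventures.PercRepro2.Independence
import Summits.Ventures.PercRepro2.Harris
import Summits.Ventures.PercRepro2.Graph
import Summits.Ventures.PercRepro2.Events
import Summits.Ventures.PercRepro2.Induced
import Summits.Ventures.PercRepro2.ObsIndependence
import Summits.Ventures.PercRepro2.BHK
import Summits.Ventures.PercRepro2.BHKEvents
import Summits.Ventures.PercRepro2.Explore

/-!
# Conditional means and covariances over the records of a stopping rule
(blind cell PercRepro2, mine-2 g19; the generic half of the pinned-model lemma for (PS),
conjectures/MINE-2.md M2-39; ASSIGNMENTS v12.64 «write the record law ρ and the four conditional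
probabilities as a pinned-model lemma first»)

Finite weighted bond percolation (`expect p`, `prob p`), an event `A`, observables `f, g`.

* `expect_centred_mul_indicator_eq`: `E[(f − c)(g − d) 1_A] = P(A) · (Cov(f, g | A) + (E[f | A] − c)(E[g | A] − d))`
  (`condMean p A f = E[f 1_A] / P(A)`, `condCov`; both sides vanish when `P(A) = 0`), for any constants `c, d`.
* `expect_centred_mul_indicator_eq_sum_records`: the same summed over the records of ANY stopping rule
  (`Explore.StoppingRule`, typer-1's `expect_eq_sum_records`): with the pinned laws `p_T = T.weights p` and
  the record weights `recWeight p T A = P(cyl T ∩ A)` (the record law `ρ` restricted to `A`; `sum_recWeight`),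
  `E[(f − c)(g − d) 1_A] = Σ_T P(T, A) · (Cov_{p_T}(f, g | A) + (E_{p_T}[f | A] − c)(E_{p_T}[g | A] − d))`.
* `condCov_nonneg_of_bracket`: a conditional covariance is `≥ 0` once its cleared bracket
  `E[f 1_A] E[g 1_A] ≤ E[f g 1_A] P(A)` is (the shape of every BHK-type inequality of the tree).
* The pinned law lives on the cylinder (`weight_weights_eq_zero_of_notMem_cyl`, `expect_weights_congr`):
  when `Q ∩ cyl T ⊆ U` the conditional quantities given `T, Q ∩ U` are those given `T, Q`
  (`condMean_weights_inter_eq`, `condCov_weights_inter_eq`); when `Q ∩ cyl T ⊆ Uᶜ` they vanish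
  (`condCov_weights_eq_zero_of_disjoint`).  `DecidesGiven rule Q U`: every record is of one of the two kinds.
* `expect_eq_of_dependsOn_of_eqOn`: an observable determined by the edges in `F` has the same expectation
  under two weight vectors agreeing on `F` — so an observable of `G ∖ W` has the same law under `p` and
  `p_T` whenever `T.explored ⊆ touches W`.

The percolation instance ((PS), its record form, BHK 1.3 at `p_T`, the tower identity for the four
conditional probabilities) is `PSRecords.lean`.
-/

namespace Summit.Ventures.PercRepro2

namespace CondRecords

/-! ## Centred products under an event: the exact algebra -/

section Algebra

variable {E : Type*} [Fintype E] [DecidableEq E] {R : Type*} [CommRing R]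

/-- `E[(f − c)(g − d) 1_A] = E[f g 1_A] − d E[f 1_A] − c E[g 1_A] + c d P(A)`. -/
lemma expect_centred_mul_indicator (p : E → R) (A : Set (Config E)) (f g : Config E → R)
    (c d : R) :
    expect p (fun ω => (f ω - c) * (g ω - d) * A.indicator 1 ω) =
      expect p (fun ω => f ω * g ω * A.indicator 1 ω) -
        d * expect p (fun ω => f ω * A.indicator 1 ω) -
        c * expect p (fun ω => g ω * A.indicator 1 ω) + c * d * prob p A := by
  rw [prob_eq_expect_indicator]
  unfold expect
  rw [Finset.mul_sum, Finset.mul_sum, Finset.mul_sum, ← Finset.sum_sub_distrib,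
    ← Finset.sum_sub_distrib, ← Finset.sum_add_distrib]
  exact Finset.sum_congr rfl fun ω _ => by ring

/-- The cleared form: with `M = P(A)`, `a = E[f 1_A]`, `b = E[g 1_A]`, `m = E[f g 1_A]`,
`M · E[(f − c)(g − d) 1_A] = (M m − a b) + (a − c M)(b − d M)`. -/
lemma prob_mul_expect_centred (p : E → R) (A : Set (Config E)) (f g : Config E → R) (c d : R) :
    prob p A * expect p (fun ω => (f ω - c) * (g ω - d) * A.indicator 1 ω) =
      (prob p A * expect p (fun ω => f ω * g ω * A.indicator 1 ω) -
          expect p (fun ω => f ω * A.indicator 1 ω) * expect p (fun ω => g ω * A.indicator 1 ω)) +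
        (expect p (fun ω => f ω * A.indicator 1 ω) - c * prob p A) *
          (expect p (fun ω => g ω * A.indicator 1 ω) - d * prob p A) := by
  rw [expect_centred_mul_indicator]
  ring

end Algebra

/-! ## Conditional means and covariances -/

section Cond

variable {E : Type*} [Fintype E] [DecidableEq E] {R : Type*} [Field R] [LinearOrder R]
  [IsStrictOrderedRing R]

omit [LinearOrder R] [IsStrictOrderedRing R] in
/-- The conditional mean `E[f | A] = E[f 1_A] / P(A)` (`0` when `P(A) = 0`). -/
noncomputable def condMean (p : E → R) (A : Set (Config E)) (f : Config E → R) : R :=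
  expect p (fun ω => f ω * A.indicator 1 ω) / prob p A

omit [LinearOrder R] [IsStrictOrderedRing R] in
/-- The conditional covariance `Cov(f, g | A) = E[f g | A] − E[f | A] · E[g | A]`. -/
noncomputable def condCov (p : E → R) (A : Set (Config E)) (f g : Config E → R) : R :=
  expect p (fun ω => f ω * g ω * A.indicator 1 ω) / prob p A - condMean p A f * condMean p A g

/-- If `P(A) = 0` then `E[f 1_A] = 0`: every configuration of `A` has weight `0`. -/
lemma expect_mul_indicator_eq_zero_of_prob_eq_zero {p : E → R} (hp : IsProbVec p)
    {A : Set (Config E)} (h : prob p A = 0) (f : Config E → R) :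
    expect p (fun ω => f ω * A.indicator 1 ω) = 0 := by
  unfold prob at h
  have hz := (Finset.sum_eq_zero_iff_of_nonneg fun ω _ =>
    Set.indicator_apply_nonneg fun _ => weight_nonneg hp ω).1 h
  unfold expect
  refine Finset.sum_eq_zero fun ω _ => ?_
  beta_reduce
  by_cases hA : ω ∈ A
  · have hw := hz ω (Finset.mem_univ ω)
    rw [Set.indicator_of_mem hA] at hw
    rw [hw, zero_mul]
  · rw [Set.indicator_of_notMem hA, mul_zero, mul_zero]

/-- **The centred product under an event**:
`E[(f − c)(g − d) 1_A] = P(A) · (Cov(f, g | A) + (E[f | A] − c)(E[g | A] − d))`; both sides vanish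
when `P(A) = 0`. -/
theorem expect_centred_mul_indicator_eq {p : E → R} (hp : IsProbVec p) (A : Set (Config E))
    (f g : Config E → R) (c d : R) :
    expect p (fun ω => (f ω - c) * (g ω - d) * A.indicator 1 ω) =
      prob p A * (condCov p A f g + (condMean p A f - c) * (condMean p A g - d)) := by
  by_cases hM : prob p A = 0
  · rw [hM, zero_mul]
    exact expect_mul_indicator_eq_zero_of_prob_eq_zero hp hM _
  · have hM' : prob p A ≠ 0 := hM
    apply mul_left_cancel₀ hM'
    rw [prob_mul_expect_centred]
    unfold condCov condMean
    field_simp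

/-- A conditional covariance is nonnegative once its cleared bracket is:
`E[f 1_A] · E[g 1_A] ≤ E[f g 1_A] · P(A)` gives `0 ≤ Cov(f, g | A)`. -/
lemma condCov_nonneg_of_bracket {p : E → R} (hp : IsProbVec p) (A : Set (Config E))
    {f g : Config E → R}
    (h : expect p (fun ω => f ω * A.indicator 1 ω) * expect p (fun ω => g ω * A.indicator 1 ω) ≤
      expect p (fun ω => f ω * g ω * A.indicator 1 ω) * prob p A) :
    0 ≤ condCov p A f g := by
  unfold condCov condMean
  by_cases hQ : prob p A = 0
  · simp [hQ]
  · have hP : 0 < prob p A := lt_of_le_of_ne (prob_nonneg hp _) (Ne.symm hQ)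
    rw [div_mul_div_comm, div_sub_div _ _ hQ (mul_ne_zero hQ hQ)]
    refine div_nonneg ?_ (mul_nonneg hP.le (mul_nonneg hP.le hP.le))
    nlinarith [h, hP]

end Cond

/-! ## The disintegration over the records of a stopping rule -/

section Records

variable {E : Type*} [Fintype E] [DecidableEq E] {R : Type*} [Field R] [LinearOrder R]
  [IsStrictOrderedRing R]

omit [LinearOrder R] [IsStrictOrderedRing R] in
/-- The weight of a record on an event: `P(cyl T ∩ A) = mass T · P_{p_T}(A)` — the record law `ρ`
restricted to `A`. -/
noncomputable def recWeight (p : E → R) (T : Explore.Record E) (A : Set (Config E)) : R :=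
  T.mass p * prob (T.weights p) A

omit [LinearOrder R] [IsStrictOrderedRing R] in
/-- `recWeight p T A = P(A ∩ cyl T)`. -/
lemma recWeight_eq_prob (p : E → R) (T : Explore.Record E) (A : Set (Config E)) :
    recWeight p T A = prob p (A ∩ T.cyl) :=
  (Explore.prob_inter_cyl T p A).symm

/-- Record weights are nonnegative. -/
lemma recWeight_nonneg {p : E → R} (hp : IsProbVec p) (T : Explore.Record E)
    (A : Set (Config E)) : 0 ≤ recWeight p T A :=
  mul_nonneg (Explore.mass_nonneg T hp) (prob_nonneg (Explore.isProbVec_weights T hp) A)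

omit [LinearOrder R] [IsStrictOrderedRing R] in
/-- The record weights of a stopping rule sum to `P(A)`: the record law is a probability law. -/
lemma sum_recWeight (rule : Explore.StoppingRule E) (p : E → R) (A : Set (Config E)) :
    ∑ T ∈ rule.records, recWeight p T A = prob p A :=
  (rule.prob_eq_sum_records p A).symm

/-- **The record decomposition of a centred product** (any stopping rule):
`E[(f − c)(g − d) 1_A] = Σ_T P(T, A) · (Cov_{p_T}(f, g | A) + (E_{p_T}[f | A] − c)(E_{p_T}[g | A] − d))`. -/
theorem expect_centred_mul_indicator_eq_sum_records (rule : Explore.StoppingRule E) {p : E → R}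
    (hp : IsProbVec p) (A : Set (Config E)) (f g : Config E → R) (c d : R) :
    expect p (fun ω => (f ω - c) * (g ω - d) * A.indicator 1 ω) =
      ∑ T ∈ rule.records, recWeight p T A *
        (condCov (T.weights p) A f g +
          (condMean (T.weights p) A f - c) * (condMean (T.weights p) A g - d)) := by
  rw [rule.expect_eq_sum_records]
  refine Finset.sum_congr rfl fun T _ => ?_
  rw [expect_centred_mul_indicator_eq (Explore.isProbVec_weights T hp)]
  unfold recWeight
  ring

omit [LinearOrder R] [IsStrictOrderedRing R] in
/-- Off its cylinder, the pinned law of a record has weight `0`. -/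
lemma weight_weights_eq_zero_of_notMem_cyl (T : Explore.Record E) (p : E → R) {ω : Config E}
    (h : ω ∉ T.cyl) : weight (T.weights p) ω = 0 := by
  unfold weight
  by_cases hA : ∀ e ∈ T.op, ω e = true
  · have hB : ∃ e ∈ T.cl, ω e = true := by
      by_contra hcon
      refine h ⟨hA, fun e he => ?_⟩
      cases hω : ω e
      · rfl
      · exact absurd ⟨e, he, hω⟩ hcon
    obtain ⟨e, he, hω⟩ := hB
    refine Finset.prod_eq_zero (Finset.mem_univ e) ?_
    have ho : e ∉ T.op := Finset.disjoint_right.1 T.disj he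
    simp [Explore.Record.weights, ho, he, hω]
  · have hA' : ∃ e ∈ T.op, ω e = false := by
      by_contra hcon
      refine hA fun e he => ?_
      cases hω : ω e
      · exact absurd ⟨e, he, hω⟩ hcon
      · rfl
    obtain ⟨e, he, hω⟩ := hA'
    refine Finset.prod_eq_zero (Finset.mem_univ e) ?_
    simp [Explore.Record.weights, he, hω]

omit [LinearOrder R] [IsStrictOrderedRing R] in
/-- Two observables agreeing on the cylinder have the same expectation under the pinned law. -/
lemma expect_weights_congr (T : Explore.Record E) (p : E → R) {f g : Config E → R}
    (h : ∀ ω ∈ T.cyl, f ω = g ω) : expect (T.weights p) f = expect (T.weights p) g := by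
  unfold expect
  refine Finset.sum_congr rfl fun ω _ => ?_
  by_cases hω : ω ∈ T.cyl
  · rw [h ω hω]
  · rw [weight_weights_eq_zero_of_notMem_cyl T p hω, zero_mul, zero_mul]

omit [LinearOrder R] [IsStrictOrderedRing R] in
/-- If `Q ∩ cyl T ⊆ U` then `1_{Q ∩ U} = 1_Q` under the pinned law. -/
lemma expect_mul_indicator_inter_eq_of_subset (T : Explore.Record E) (p : E → R)
    {Q U : Set (Config E)} (hU : ∀ ω ∈ T.cyl, ω ∈ Q → ω ∈ U) (f : Config E → R) :
    expect (T.weights p) (fun ω => f ω * (Q ∩ U).indicator 1 ω) =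
      expect (T.weights p) (fun ω => f ω * Q.indicator 1 ω) := by
  refine expect_weights_congr T p fun ω hω => ?_
  by_cases hQ : ω ∈ Q
  · rw [Set.indicator_of_mem (show ω ∈ Q ∩ U from ⟨hQ, hU ω hω hQ⟩), Set.indicator_of_mem hQ]
  · rw [Set.indicator_of_notMem (show ω ∉ Q ∩ U from fun h' => hQ h'.1),
      Set.indicator_of_notMem hQ]

omit [LinearOrder R] [IsStrictOrderedRing R] in
/-- If `Q ∩ cyl T ⊆ U` then `P_{p_T}(Q ∩ U) = P_{p_T}(Q)`. -/
lemma prob_weights_inter_eq_of_subset (T : Explore.Record E) (p : E → R)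
    {Q U : Set (Config E)} (hU : ∀ ω ∈ T.cyl, ω ∈ Q → ω ∈ U) :
    prob (T.weights p) (Q ∩ U) = prob (T.weights p) Q := by
  rw [prob_eq_expect_indicator, prob_eq_expect_indicator]
  refine expect_weights_congr T p fun ω hω => ?_
  by_cases hQ : ω ∈ Q
  · rw [Set.indicator_of_mem (show ω ∈ Q ∩ U from ⟨hQ, hU ω hω hQ⟩), Set.indicator_of_mem hQ]
  · rw [Set.indicator_of_notMem (show ω ∉ Q ∩ U from fun h' => hQ h'.1),
      Set.indicator_of_notMem hQ]

omit [LinearOrder R] [IsStrictOrderedRing R] in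
/-- If `Q ∩ cyl T ⊆ Uᶜ` then `E_{p_T}[f 1_{Q ∩ U}] = 0`. -/
lemma expect_mul_indicator_inter_eq_zero_of_disjoint (T : Explore.Record E) (p : E → R)
    {Q U : Set (Config E)} (hU : ∀ ω ∈ T.cyl, ω ∈ Q → ω ∉ U) (f : Config E → R) :
    expect (T.weights p) (fun ω => f ω * (Q ∩ U).indicator 1 ω) = 0 := by
  refine (expect_weights_congr T p (g := fun _ => 0) fun ω hω => ?_).trans (expect_const _ _)
  rw [Set.indicator_of_notMem (show ω ∉ Q ∩ U from fun h' => hU ω hω h'.1 h'.2), mul_zero]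

omit [LinearOrder R] [IsStrictOrderedRing R] in
/-- With `Q ∩ cyl T ⊆ U`, the conditional mean given `T, Q ∩ U` is the one given `T, Q`. -/
lemma condMean_weights_inter_eq (T : Explore.Record E) (p : E → R) {Q U : Set (Config E)}
    (hU : ∀ ω ∈ T.cyl, ω ∈ Q → ω ∈ U) (f : Config E → R) :
    condMean (T.weights p) (Q ∩ U) f = condMean (T.weights p) Q f := by
  unfold condMean
  rw [expect_mul_indicator_inter_eq_of_subset T p hU, prob_weights_inter_eq_of_subset T p hU]

omit [LinearOrder R] [IsStrictOrderedRing R] in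
/-- With `Q ∩ cyl T ⊆ U`, the conditional covariance given `T, Q ∩ U` is the one given `T, Q`. -/
lemma condCov_weights_inter_eq (T : Explore.Record E) (p : E → R) {Q U : Set (Config E)}
    (hU : ∀ ω ∈ T.cyl, ω ∈ Q → ω ∈ U) (f g : Config E → R) :
    condCov (T.weights p) (Q ∩ U) f g = condCov (T.weights p) Q f g := by
  unfold condCov
  rw [expect_mul_indicator_inter_eq_of_subset T p hU (fun ω => f ω * g ω),
    prob_weights_inter_eq_of_subset T p hU, condMean_weights_inter_eq T p hU,
    condMean_weights_inter_eq T p hU]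

omit [LinearOrder R] [IsStrictOrderedRing R] in
/-- With `Q ∩ cyl T ⊆ Uᶜ`, the conditional covariance given `T, Q ∩ U` vanishes. -/
lemma condCov_weights_eq_zero_of_disjoint (T : Explore.Record E) (p : E → R)
    {Q U : Set (Config E)} (hU : ∀ ω ∈ T.cyl, ω ∈ Q → ω ∉ U) (f g : Config E → R) :
    condCov (T.weights p) (Q ∩ U) f g = 0 := by
  unfold condCov condMean
  rw [expect_mul_indicator_inter_eq_zero_of_disjoint T p hU (fun ω => f ω * g ω),
    expect_mul_indicator_inter_eq_zero_of_disjoint T p hU f,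
    expect_mul_indicator_inter_eq_zero_of_disjoint T p hU g]
  simp

omit [LinearOrder R] [IsStrictOrderedRing R] in
/-- A stopping rule DECIDES `U` given `Q` when, on every record, `Q ∩ cyl T` lies inside `U` or
inside `Uᶜ`. -/
def DecidesGiven (rule : Explore.StoppingRule E) (Q U : Set (Config E)) : Prop :=
  ∀ T ∈ rule.records, (∀ ω ∈ T.cyl, ω ∈ Q → ω ∈ U) ∨ (∀ ω ∈ T.cyl, ω ∈ Q → ω ∉ U)

end Records

/-! ## Observables of `G ∖ W` under two laws agreeing off `touches W` -/

section EqOn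

variable {E : Type*} [Fintype E] [DecidableEq E] {R : Type*} [CommRing R]

/-- An observable determined by the edges in `F` has the same expectation under two weight vectors
agreeing on `F`. -/
theorem expect_eq_of_dependsOn_of_eqOn {p p' : E → R} (F : Set E) [DecidablePred (· ∈ F)]
    {f : Config E → R} (hf : DependsOn f F) (hpp : ∀ e ∈ F, p e = p' e) :
    expect p f = expect p' f := by
  let a : ({e // e ∈ F} → Bool) → R := fun σ₁ => f (glue F σ₁ fun _ => false)
  have ha : ∀ σ₁ σ₂, f (glue F σ₁ σ₂) = a σ₁ := fun σ₁ σ₂ =>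
    hf fun i hi => by rw [glue_apply_of_mem F _ _ hi, glue_apply_of_mem F _ _ hi]
  have e1 : ∀ q : E → R, expect q f = ∑ σ₁, weight (fun i : {e // e ∈ F} => q i) σ₁ * a σ₁ := by
    intro q
    rw [expect_eq_sum_glue q _ F]
    refine Finset.sum_congr rfl fun σ₁ _ => ?_
    calc ∑ σ₂, weight (fun i : {e // e ∈ F} => q i) σ₁ * weight (fun i : {e // e ∉ F} => q i) σ₂
          * f (glue F σ₁ σ₂)
        = ∑ σ₂, (weight (fun i : {e // e ∈ F} => q i) σ₁ * a σ₁) *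
            weight (fun i : {e // e ∉ F} => q i) σ₂ :=
          Finset.sum_congr rfl fun σ₂ _ => by rw [ha]; ring
      _ = weight (fun i : {e // e ∈ F} => q i) σ₁ * a σ₁ := by
          rw [← Finset.mul_sum, sum_weight, mul_one]
  have hw : (fun i : {e // e ∈ F} => p i) = fun i : {e // e ∈ F} => p' i :=
    funext fun i => hpp i i.2
  rw [e1 p, e1 p', hw]

end EqOn

end CondRecords

end Summit.Ventures.PercRepro2
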